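import Summits.Langlands.Langlands.Theses.ExteriorSquareAscent
import Literature.NumberTheory.Automorphic.PairLAnalyticPackageRankEq

/-!
# Stub `stub_pairPackage` of line `Sketch` for crux stmt-Langlands-18054
(`Summit.Langlands.Langlands.Theses.ExteriorSquareAscent.ReducibleInducesSquare`)

Helper-stub H1 of the `(2,2)` analytic stub: the analytic package of the partial Rankin–Selberg
`L`-function `L^S(s, π₁ × π₂)` of two cuspidal Borel–Jacquet data `π₁`, `π₂` on `GL_n(𝔸_F)` of the
SAME rank with Satake families `β₁`, `β₂` unitary almost everywhere — multipliability on `Re s > 1`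
((2.1), the theorem `JacquetShalika1981_multipliable_partialPairL_repData_holds`), continuity and
non-vanishing on `Re s > 1` (Jacquet–Shalika I, Thm. 5.3, the theorem
`continuousAt_and_ne_zero_partialPairL_repData`), the simple pole at `s = 1` when `t_{π₁} = t_{π₂}⁻¹`
a.e. ((2.3), the hypothesis `JacquetShalika1981_partialPairL_pole_repData`) and the finite non-zero
boundary value at `s = 1` otherwise ((2.2), the hypothesis
`JacquetShalika1981_partialPairL_boundary_repData`).  All the work is the library theorem
`Literature.NumberTheory.Automorphic.analyticPackage_pair`
(`Literature/NumberTheory/Automorphic/PairLAnalyticPackageRankEq`, landed with this stub); this file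
is the registered restatement.
-/

set_option linter.dupNamespace false -- `Summit.Langlands.Langlands` is the mandated namespace

noncomputable section

namespace Summit.Langlands.Langlands.Cruxes.ReducibleInducesSquare.Sketch

/-- **HELPER-STUB H1 — the analytic package of `L^S(s, π₁ × π₂)` in equal rank (Arthur–Clozel,
Ch. 3, (2.1)–(2.3)).**  For cuspidal Borel–Jacquet data `π₁`, `π₂` on `GL_n(𝔸_F)` with Satake
families `β₁`, `β₂` at almost all places, unitary almost everywhere, and granting Jacquet–Shalika
(2.2) and (2.3) for Borel–Jacquet data: there is a finite `S₀` such that for every finite `S ⊇ S₀`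
the Euler product `L^S(s, π₁ × π₂) = partialPairL S β₁ β₂ s` is multipliable at every `s` with
`Re s > 1`, continuous and non-zero there, has a simple pole with non-zero residue at `s = 1` if
`t_{π₁,w} = t_{π₂,w}⁻¹` for almost all `w`, and a finite non-zero limit as `s → 1`, `Re s > 1`,
otherwise (`Literature.NumberTheory.Automorphic.analyticPackage_pair`).
[cite: ArthurClozelAMS120, Ch. 3 §2 (2.1)–(2.3)] -/
theorem stub_pairPackage :
    ∀ (F : Type) [Field F] [NumberField F] (n : ℕ) [NeZero n]
      (hF : Literature.NumberTheory.Automorphic.isCompact_glFiniteIntegralLevel n F),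
      Literature.NumberTheory.Automorphic.JacquetShalika1981_partialPairL_boundary_repData →
      Literature.NumberTheory.Automorphic.JacquetShalika1981_partialPairL_pole_repData →
      ∀ (P₁ P₂ : Literature.NumberTheory.Automorphic.CuspidalAutomorphicRepData n F hF)
        (β₁ β₂ : Literature.NumberTheory.Automorphic.SatakeFamily F),
        (∀ᶠ w : IsDedekindDomain.HeightOneSpectrum (NumberField.RingOfIntegers F) in Filter.cofinite,
          P₁.1.HasSatakeParamAt w (β₁ w)) →
        (∀ᶠ w : IsDedekindDomain.HeightOneSpectrum (NumberField.RingOfIntegers F) in Filter.cofinite,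
          P₂.1.HasSatakeParamAt w (β₂ w)) →
        (∀ᶠ w : IsDedekindDomain.HeightOneSpectrum (NumberField.RingOfIntegers F) in Filter.cofinite,
          ‖(β₁ w).prod‖ = 1) →
        (∀ᶠ w : IsDedekindDomain.HeightOneSpectrum (NumberField.RingOfIntegers F) in Filter.cofinite,
          ‖(β₂ w).prod‖ = 1) →
        ∃ S₀ : Set (IsDedekindDomain.HeightOneSpectrum (NumberField.RingOfIntegers F)), S₀.Finite ∧
          ∀ (S : Set (IsDedekindDomain.HeightOneSpectrum (NumberField.RingOfIntegers F))),
            S.Finite → S₀ ⊆ S →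
            (∀ s : ℂ, 1 < s.re → Multipliable fun v :
                {v : IsDedekindDomain.HeightOneSpectrum (NumberField.RingOfIntegers F) // v ∉ S} =>
              ((Literature.NumberTheory.Automorphic.satakePairPolynomial (β₁ v.1) (β₂ v.1)).eval
                ((v.1.residueCard : ℂ) ^ (-s)))⁻¹) ∧
            (∀ s : ℂ, 1 < s.re →
              ContinuousAt (Literature.NumberTheory.Automorphic.partialPairL S β₁ β₂) s ∧
                Literature.NumberTheory.Automorphic.partialPairL S β₁ β₂ s ≠ 0) ∧
            ((∀ᶠ w : IsDedekindDomain.HeightOneSpectrum (NumberField.RingOfIntegers F) in Filter.cofinite,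
                β₁ w = (β₂ w).map (·⁻¹)) →
              ∃ c : ℂ, c ≠ 0 ∧ Filter.Tendsto
                (fun s : ℂ => (s - 1) * Literature.NumberTheory.Automorphic.partialPairL S β₁ β₂ s)
                (nhdsWithin 1 {s : ℂ | 1 < s.re}) (nhds c)) ∧
            ((¬ ∀ᶠ w : IsDedekindDomain.HeightOneSpectrum (NumberField.RingOfIntegers F) in Filter.cofinite,
                β₁ w = (β₂ w).map (·⁻¹)) →
              ∃ c : ℂ, c ≠ 0 ∧ Filter.Tendsto (Literature.NumberTheory.Automorphic.partialPairL S β₁ β₂)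
                (nhdsWithin 1 {s : ℂ | 1 < s.re}) (nhds c)) :=
  Literature.NumberTheory.Automorphic.analyticPackage_pair

end Summit.Langlands.Langlands.Cruxes.ReducibleInducesSquare.Sketch
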